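import Literature.NumberTheory.Transcendental.RosenlichtProp4Residues
import Literature.RingTheory.PowerSeries.LaurentSeriesConstants
import Mathlib
import HarnessLib

/-!
# Rosenlicht property of the algebraic elements of the differential field `(ℝ⸨X⸩, d/dX)`

Stub `stub_rosenlichtProperty` of line `ax-schanuel-germs` (crux `LogPrimitiveNL`).

Let `F = ℝ(X)` (`RatFunc ℝ`, embedded in `ℝ⸨X⸩` by the scoped instance `RatFunc.liftAlgebra`),
`D = d/dX` (`LaurentSeries.derivative`) and `K ⊆ ℝ⸨X⸩` the relative algebraic closure of `F`
(the elements algebraic over `F`; handled below as an intermediate field over `ℝ`, characterised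
by the membership predicate `x ∈ K ↔ IsAlgebraic F x`).

1. `D` maps `F` into `F` (quotient rule) and hence `K` into `K`: differentiate an algebraic
   equation coefficientwise (`Rosenlicht.derivation_mem_of_eval_eq_zero`).
2. Every `ℝ`-derivation `δ` of `K` is `δ(X) · D|_K`: the difference kills `ℝ[X]`, hence `ℝ(X)`,
   hence the algebraic extension `K`. So a relation `Σ C(eⱼ) · D uⱼ / uⱼ + D v = 0` with `uⱼ, v ∈ K`
   holds for every `ℝ`-derivation of `K`, and Rosenlicht's Prop. 4 (dual form,
   `Rosenlicht.isAlgebraic_of_forall_derivation`) makes the `uⱼ` algebraic over `ℝ`, hence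
   constant (`Rosenlicht.derivation_eq_zero_of_isAlgebraic`).

Implementation note: Mathlib has two (propositionally but not definitionally equal) `ℝ`-algebra
structures on `ℝ⸨X⸩`, `HahnSeries.instAlgebra` (coefficientwise scalar action, the one underlying
the `ℝ`-linear map `LaurentSeries.derivative`) and `HahnSeries.powerSeriesAlgebra`; we give the
former priority locally so that all `ℝ`-module structures in sight are coherent. The statement
of the stub does not depend on this choice.
-/

noncomputable section

open Set MeasureTheory Filter
open scoped ContDiff Topology LaurentSeries RatFunc
open Literature.NumberTheory.Transcendental

namespace Summit.KontsevichZagierPeriods.LiouvilleUnfolding.LogPrimitiveNL.AxSchanuelGerms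

open Literature.RingTheory.PowerSeries Polynomial

attribute [local instance 1100] HahnSeries.instAlgebra

/-! ### The embeddings `ℝ ⊆ ℝ[X] ⊆ ℝ(X) ⊆ ℝ⸨X⸩` and the derivation `d/dX` -/

/-- `ℝ⸨X⸩` has characteristic zero. [folklore] -/
private theorem rosenProp_charZero_laurentSeries : CharZero ℝ⸨X⸩ :=
  charZero_of_injective_algebraMap (algebraMap ℝ ℝ⸨X⸩).injective

/-- The structure map `ℝ → ℝ⸨X⸩` is `HahnSeries.C`. [folklore] -/
private theorem rosenProp_algebraMap_real_apply (c : ℝ) : algebraMap ℝ ℝ⸨X⸩ c = HahnSeries.C c := by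
  rw [HahnSeries.algebraMap_apply]
  rfl

/-- The polynomial `p`, mapped to `ℝ⸨X⸩`, is `p(X)` with `X = single 1 1`. [folklore] -/
private theorem rosenProp_aeval_single_one_one (p : ℝ[X]) :
    aeval (HahnSeries.single 1 1 : ℝ⸨X⸩) p = algebraMap ℝ[X] ℝ⸨X⸩ p := by
  have hX : (HahnSeries.single 1 1 : ℝ⸨X⸩) = algebraMap ℝ[X] ℝ⸨X⸩ X := by
    rw [Polynomial.algebraMap_hahnSeries_apply, Polynomial.coe_X, HahnSeries.ofPowerSeries_X]
  induction p using Polynomial.induction_on with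
  | C a =>
    rw [aeval_C, rosenProp_algebraMap_real_apply, Polynomial.algebraMap_hahnSeries_apply,
      Polynomial.coe_C, HahnSeries.ofPowerSeries_C]
  | add p q hp hq => rw [map_add, map_add, hp, hq]
  | monomial n a h =>
    rw [pow_succ, ← mul_assoc, map_mul, map_mul (algebraMap ℝ[X] ℝ⸨X⸩) (C a * X ^ n) X, h,
      aeval_X, hX]

/-- `ℝ → ℝ(X) → ℝ⸨X⸩` is a scalar tower (constants go to constants). [folklore] -/
private theorem rosenProp_isScalarTower_ratFunc : IsScalarTower ℝ (RatFunc ℝ) ℝ⸨X⸩ := by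
  refine IsScalarTower.of_algebraMap_eq (R := ℝ) (S := RatFunc ℝ) (A := ℝ⸨X⸩) fun c => ?_
  rw [RatFunc.algebraMap_eq_C, ← RatFunc.algebraMap_C,
    ← IsScalarTower.algebraMap_apply ℝ[X] (RatFunc ℝ) ℝ⸨X⸩, ← rosenProp_aeval_single_one_one,
    aeval_C]

/-- `d/dX` of (the image of) a polynomial is (the image of) its derivative. [folklore] -/
private theorem rosenProp_derivative_algebraMap_polynomial (p : ℝ[X]) :
    LaurentSeries.derivative ℝ (algebraMap ℝ[X] ℝ⸨X⸩ p) =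
      algebraMap ℝ[X] ℝ⸨X⸩ (derivative p) := by
  rw [Polynomial.algebraMap_hahnSeries_apply, Polynomial.algebraMap_hahnSeries_apply]
  exact derivative_coe_polynomial p

/-- **`d/dX` is an `ℝ`-derivation of `ℝ⸨X⸩`** (for the coefficientwise `ℝ`-algebra structure).
[folklore] -/
private theorem rosenProp_exists_realDerivation_eq_derivative :
    ∃ D : Derivation ℝ ℝ⸨X⸩ ℝ⸨X⸩, ∀ f, D f = LaurentSeries.derivative ℝ f := by
  -- adapted from `Literature.RingTheory.PowerSeries.exists_derivation_eq_derivative`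
  -- (same construction, for the `ℝ`-algebra structure `HahnSeries.instAlgebra`)
  let D : Derivation ℝ ℝ⸨X⸩ ℝ⸨X⸩ :=
    { toFun := fun f => LaurentSeries.derivative ℝ f
      map_add' := fun f g => map_add (LaurentSeries.derivative ℝ) f g
      map_smul' := fun c f => by
        simp only [RingHom.id_apply]
        exact (LaurentSeries.derivative ℝ).map_smul c f
      map_one_eq_zero' := by
        change LaurentSeries.derivative ℝ (1 : ℝ⸨X⸩) = 0
        exact Literature.RingTheory.PowerSeries.derivative_one
      leibniz' := by
        intro a b
        change LaurentSeries.derivative ℝ (a * b) =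
          a • LaurentSeries.derivative ℝ b + b • LaurentSeries.derivative ℝ a
        rw [Literature.RingTheory.PowerSeries.derivative_mul, smul_eq_mul, smul_eq_mul]
        ring }
  exact ⟨D, fun f => rfl⟩

/-- **`d/dX` preserves `ℝ(X)`**: the derivative of a rational function is a rational function
(quotient rule). [folklore] -/
private theorem rosenProp_exists_derivative_algebraMap_ratFunc (r : RatFunc ℝ) :
    ∃ s : RatFunc ℝ, LaurentSeries.derivative ℝ (algebraMap (RatFunc ℝ) ℝ⸨X⸩ r) =
      algebraMap (RatFunc ℝ) ℝ⸨X⸩ s := by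
  obtain ⟨D, hD⟩ := rosenProp_exists_realDerivation_eq_derivative
  induction r using RatFunc.induction_on with
  | f p q _ =>
    refine ⟨(algebraMap ℝ[X] (RatFunc ℝ) (derivative p) * algebraMap ℝ[X] (RatFunc ℝ) q -
        algebraMap ℝ[X] (RatFunc ℝ) p * algebraMap ℝ[X] (RatFunc ℝ) (derivative q)) /
        (algebraMap ℝ[X] (RatFunc ℝ) q) ^ 2, ?_⟩
    rw [RatFunc.algebraMap_apply_div, ← hD, D.leibniz_div, hD, hD,
      rosenProp_derivative_algebraMap_polynomial, rosenProp_derivative_algebraMap_polynomial]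
    simp only [map_div₀, map_pow, map_sub, map_mul, ← IsScalarTower.algebraMap_apply,
      smul_eq_mul]
    ring

/-! ### The relative algebraic closure `K` of `ℝ(X)` in `ℝ⸨X⸩` -/

/-- Every element of `K` is the root of a non-zero polynomial over `K` whose coefficients are
rational functions (its equation over `ℝ(X)`, with coefficients viewed in `K`). [folklore] -/
private theorem rosenProp_exists_polynomial_ratFunc_coeff (K : IntermediateField ℝ ℝ⸨X⸩)
    (hK : ∀ x, x ∈ K ↔ IsAlgebraic (RatFunc ℝ) x) (y : K) :
    ∃ Q : Polynomial K, Q ≠ 0 ∧ Q.eval y = 0 ∧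
      ∀ i, ∃ r : RatFunc ℝ, ((Q.coeff i : K) : ℝ⸨X⸩) = algebraMap (RatFunc ℝ) ℝ⸨X⸩ r := by
  obtain ⟨p, hp0, hpy⟩ := (hK (y : ℝ⸨X⸩)).1 y.2
  set P : Polynomial ℝ⸨X⸩ := p.map (algebraMap (RatFunc ℝ) ℝ⸨X⸩) with hP
  have hP0 : P ≠ 0 := (Polynomial.map_ne_zero_iff (algebraMap (RatFunc ℝ) ℝ⸨X⸩).injective).2 hp0
  have hlift : P ∈ Polynomial.lifts (algebraMap K ℝ⸨X⸩) := by
    rw [Polynomial.lifts_iff_coeff_lifts]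
    intro i
    refine ⟨⟨P.coeff i, ?_⟩, rfl⟩
    rw [hP, Polynomial.coeff_map]
    exact (hK _).2 (isAlgebraic_algebraMap _)
  obtain ⟨Q, hQ⟩ := (Polynomial.mem_lifts P).1 hlift
  refine ⟨Q, ?_, ?_, fun i => ⟨p.coeff i, ?_⟩⟩
  · rintro rfl
    rw [Polynomial.map_zero] at hQ
    exact hP0 hQ.symm
  · apply (algebraMap K ℝ⸨X⸩).injective
    rw [← Polynomial.eval₂_hom, ← Polynomial.eval_map, hQ, map_zero,
      IntermediateField.algebraMap_apply, hP, Polynomial.eval_map_algebraMap]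
    exact hpy
  · have h := congrArg (fun R : Polynomial ℝ⸨X⸩ => R.coeff i) hQ
    simp only [Polynomial.coeff_map, hP] at h
    exact h

/-- **`K` is stable under `d/dX`** (differentiate the algebraic equation coefficientwise: the
derivatives of the coefficients are rational, `Rosenlicht.derivation_mem_of_eval_eq_zero`).
[folklore] -/
private theorem rosenProp_derivative_mem (K : IntermediateField ℝ ℝ⸨X⸩)
    (hK : ∀ x, x ∈ K ↔ IsAlgebraic (RatFunc ℝ) x) {x : ℝ⸨X⸩} (hx : x ∈ K) :
    LaurentSeries.derivative ℝ x ∈ K := by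
  haveI : CharZero K := charZero_of_injective_algebraMap (algebraMap ℝ K).injective
  obtain ⟨D, hD⟩ := rosenProp_exists_realDerivation_eq_derivative
  obtain ⟨Q, hQ0, hQy, hQc⟩ := rosenProp_exists_polynomial_ratFunc_coeff K hK ⟨x, hx⟩
  let δ : Derivation ℝ K ℝ⸨X⸩ := D.compAlgebraMap K
  have hδ : ∀ y : K, δ y = D (y : ℝ⸨X⸩) := fun _ => rfl
  let N : Submodule K ℝ⸨X⸩ := LinearMap.range (Algebra.linearMap K ℝ⸨X⸩)
  have hN : ∀ z : ℝ⸨X⸩, z ∈ N ↔ z ∈ K := fun z => by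
    constructor
    · rintro ⟨y, rfl⟩
      exact y.2
    · intro hz
      exact ⟨⟨z, hz⟩, rfl⟩
  have hcoef : ∀ i, δ (Q.coeff i) ∈ N := fun i => by
    obtain ⟨r, hr⟩ := hQc i
    obtain ⟨s, hs⟩ := rosenProp_exists_derivative_algebraMap_ratFunc r
    rw [hN, hδ, hr, hD, hs]
    exact (hK _).2 (isAlgebraic_algebraMap s)
  have h := Rosenlicht.derivation_mem_of_eval_eq_zero δ N hQ0 hcoef hQy
  rw [hN, hδ, hD] at h
  exact h

/-- A derivation of `K` over `ℝ` which kills `X` kills every element of `K` which is a rational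
function (`K ∋ p(X)/q(X)`). [folklore] -/
private theorem rosenProp_derivation_eq_zero_of_eq_algebraMap (K : IntermediateField ℝ ℝ⸨X⸩)
    (hX : (HahnSeries.single 1 1 : ℝ⸨X⸩) ∈ K) (ε : Derivation ℝ K K)
    (hε : ε ⟨HahnSeries.single 1 1, hX⟩ = 0) (r : RatFunc ℝ) :
    ∀ z : K, (z : ℝ⸨X⸩) = algebraMap (RatFunc ℝ) ℝ⸨X⸩ r → ε z = 0 := by
  induction r using RatFunc.induction_on with
  | f p q _ =>
    intro z hz
    have hp : ε (aeval (⟨HahnSeries.single 1 1, hX⟩ : K) p) = 0 := by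
      rw [Derivation.map_aeval, hε, smul_zero]
    have hq : ε (aeval (⟨HahnSeries.single 1 1, hX⟩ : K) q) = 0 := by
      rw [Derivation.map_aeval, hε, smul_zero]
    have hzeq : z = aeval (⟨HahnSeries.single 1 1, hX⟩ : K) p /
        aeval (⟨HahnSeries.single 1 1, hX⟩ : K) q := by
      apply Subtype.val_injective
      rw [IntermediateField.coe_div, ← IntermediateField.aeval_coe, ← IntermediateField.aeval_coe,
        hz, RatFunc.algebraMap_apply_div]
      change _ = aeval (HahnSeries.single 1 1 : ℝ⸨X⸩) p / aeval (HahnSeries.single 1 1 : ℝ⸨X⸩) q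
      rw [rosenProp_aeval_single_one_one, rosenProp_aeval_single_one_one]
    rw [hzeq, ε.leibniz_div, hp, hq, smul_zero, smul_zero, sub_zero, smul_zero]

/-- **Derivations of `K` over `ℝ` are determined by their value at `X`, vanishing form**: an
`ℝ`-derivation of `K` killing `X` is zero (it kills `ℝ(X)`, and `K` is algebraic over `ℝ(X)`:
differentiate the equation, `Rosenlicht.derivation_mem_of_eval_eq_zero` with `N = 0`).
[folklore] -/
private theorem rosenProp_derivation_apply_eq_zero_of_apply_X (K : IntermediateField ℝ ℝ⸨X⸩)
    (hK : ∀ x, x ∈ K ↔ IsAlgebraic (RatFunc ℝ) x) (hX : (HahnSeries.single 1 1 : ℝ⸨X⸩) ∈ K)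
    (ε : Derivation ℝ K K) (hε : ε ⟨HahnSeries.single 1 1, hX⟩ = 0) (y : K) : ε y = 0 := by
  haveI : CharZero K := charZero_of_injective_algebraMap (algebraMap ℝ K).injective
  obtain ⟨Q, hQ0, hQy, hQc⟩ := rosenProp_exists_polynomial_ratFunc_coeff K hK y
  have h := Rosenlicht.derivation_mem_of_eval_eq_zero (M := K) ε ⊥ hQ0 (fun i => ?_) hQy
  · rwa [Submodule.mem_bot] at h
  · obtain ⟨r, hr⟩ := hQc i
    rw [Submodule.mem_bot]
    exact rosenProp_derivation_eq_zero_of_eq_algebraMap K hX ε hε r _ hr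

/-- **The restriction `D|_K`** of `d/dX` to `K`, as an `ℝ`-derivation of `K`. [folklore] -/
private theorem rosenProp_exists_derivation_restrict (K : IntermediateField ℝ ℝ⸨X⸩)
    (hK : ∀ x, x ∈ K ↔ IsAlgebraic (RatFunc ℝ) x) :
    ∃ Dk : Derivation ℝ K K, ∀ y : K,
      ((Dk y : K) : ℝ⸨X⸩) = LaurentSeries.derivative ℝ (y : ℝ⸨X⸩) := by
  obtain ⟨D, hD⟩ := rosenProp_exists_realDerivation_eq_derivative
  have hmem : ∀ y : K, D (y : ℝ⸨X⸩) ∈ K := fun y => by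
    rw [hD]
    exact rosenProp_derivative_mem K hK y.2
  refine ⟨{ toFun := fun y => ⟨D y, hmem y⟩
            map_add' := fun a b => Subtype.ext ?_
            map_smul' := fun c a => Subtype.ext ?_
            map_one_eq_zero' := Subtype.ext ?_
            leibniz' := fun a b => Subtype.ext ?_ }, fun y => hD y⟩
  · change D ((a + b : K) : ℝ⸨X⸩) = D a + D b
    rw [IntermediateField.coe_add, map_add]
  · change D ((c • a : K) : ℝ⸨X⸩) = c • D a
    rw [IntermediateField.coe_smul, D.map_smul]
  · change D ((1 : K) : ℝ⸨X⸩) = 0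
    rw [IntermediateField.coe_one, D.map_one_eq_zero]
  · change D ((a * b : K) : ℝ⸨X⸩) = (a : ℝ⸨X⸩) * D b + (b : ℝ⸨X⸩) * D a
    rw [IntermediateField.coe_mul, D.leibniz, smul_eq_mul, smul_eq_mul]

/-- **Every `ℝ`-derivation of `K` is a multiple of `d/dX`**: `δ = δ(X) · D|_K`. [folklore] -/
private theorem rosenProp_derivation_apply_eq_mul (K : IntermediateField ℝ ℝ⸨X⸩)
    (hK : ∀ x, x ∈ K ↔ IsAlgebraic (RatFunc ℝ) x) (hX : (HahnSeries.single 1 1 : ℝ⸨X⸩) ∈ K)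
    (Dk : Derivation ℝ K K)
    (hDk : ∀ y : K, ((Dk y : K) : ℝ⸨X⸩) = LaurentSeries.derivative ℝ (y : ℝ⸨X⸩))
    (δ : Derivation ℝ K K) (y : K) : δ y = δ ⟨HahnSeries.single 1 1, hX⟩ * Dk y := by
  have hDX : Dk ⟨HahnSeries.single 1 1, hX⟩ = 1 := by
    apply Subtype.ext
    rw [hDk, IntermediateField.coe_one]
    exact derivative_single_one_one
  have h := rosenProp_derivation_apply_eq_zero_of_apply_X K hK hX
    (δ - δ ⟨HahnSeries.single 1 1, hX⟩ • Dk)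
    (by rw [Derivation.sub_apply, Derivation.smul_apply, smul_eq_mul, hDX, mul_one, sub_self]) y
  rwa [Derivation.sub_apply, Derivation.smul_apply, smul_eq_mul, sub_eq_zero] at h

/-- **Rosenlicht property of the algebraic elements of `(ℝ⸨X⸩, d/dX)`.** (1) The elements of
`ℝ⸨X⸩` algebraic over `ℝ(X)` are stable under `d/dX` (differentiate the minimal equation).
(2) For real constants `cⱼ = C eⱼ` with `eⱼ` linearly independent over `ℚ`, non-zero `uⱼ` and `v`
algebraic over `ℝ(X)`: `Σ cⱼ duⱼ/uⱼ + dv = 0 ⇒ duⱼ = 0` for all `j` (every `ℝ`-derivation of the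
relative algebraic closure `F` of `ℝ(X)` is an `F`-multiple of `d/dX`, so Rosenlicht 1976 Prop. 4
in the tree's dual form `Rosenlicht.isAlgebraic_of_forall_derivation` makes `uⱼ` algebraic over
`ℝ`, hence killed by `d/dX`). -/
theorem stub_rosenlichtProperty :
    (∀ x : ℝ⸨X⸩, IsAlgebraic (RatFunc ℝ) x →
      IsAlgebraic (RatFunc ℝ) (LaurentSeries.derivative ℝ x)) ∧
    (∀ (m : ℕ) (e : Fin m → ℝ) (u : Fin m → ℝ⸨X⸩) (v : ℝ⸨X⸩), LinearIndependent ℚ e →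
      (∀ j, IsAlgebraic (RatFunc ℝ) (u j)) → (∀ j, u j ≠ 0) → IsAlgebraic (RatFunc ℝ) v →
      (∑ j, HahnSeries.C (e j) * ((u j)⁻¹ * LaurentSeries.derivative ℝ (u j))) +
          LaurentSeries.derivative ℝ v = 0 →
        ∀ j, LaurentSeries.derivative ℝ (u j) = 0) := by
  haveI := rosenProp_charZero_laurentSeries
  haveI := rosenProp_isScalarTower_ratFunc
  set K : IntermediateField ℝ ℝ⸨X⸩ := (algebraicClosure (RatFunc ℝ) ℝ⸨X⸩).restrictScalars ℝ
    with hK_def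
  have hK : ∀ x, x ∈ K ↔ IsAlgebraic (RatFunc ℝ) x := fun x => by
    rw [hK_def, IntermediateField.mem_restrictScalars, mem_algebraicClosure_iff]
  refine ⟨fun x hx => (hK _).1 (rosenProp_derivative_mem K hK ((hK x).2 hx)), ?_⟩
  intro m e u v he hu hu0 hv hrel j
  haveI : CharZero K := charZero_of_injective_algebraMap (algebraMap ℝ K).injective
  have hX : (HahnSeries.single 1 1 : ℝ⸨X⸩) ∈ K := by
    refine (hK _).2 ?_
    have h : IsAlgebraic (RatFunc ℝ) (algebraMap (RatFunc ℝ) ℝ⸨X⸩ RatFunc.X) :=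
      isAlgebraic_algebraMap _
    rwa [RatFunc.coe_X] at h
  obtain ⟨Dk, hDk⟩ := rosenProp_exists_derivation_restrict K hK
  obtain ⟨u', hu'⟩ : ∃ u' : Fin m → K, ∀ i, ((u' i : K) : ℝ⸨X⸩) = u i :=
    ⟨fun i => ⟨u i, (hK _).2 (hu i)⟩, fun _ => rfl⟩
  obtain ⟨v', hv'⟩ : ∃ v' : K, ((v' : K) : ℝ⸨X⸩) = v := ⟨⟨v, (hK _).2 hv⟩, rfl⟩
  have hu'0 : ∀ i, u' i ≠ 0 := fun i h => hu0 i (by rw [← hu' i, h, ZeroMemClass.coe_zero])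
  have H : ∀ δ : Derivation ℝ K K,
      (∑ i, algebraMap ℝ K (e i) * ((u' i)⁻¹ * δ (u' i))) + δ v' = 0 := by
    intro δ
    have hδ := rosenProp_derivation_apply_eq_mul K hK hX Dk hDk δ
    set c : ℝ⸨X⸩ := ((δ ⟨HahnSeries.single 1 1, hX⟩ : K) : ℝ⸨X⸩)
    have h3 : ∀ i, ((algebraMap ℝ K (e i) * ((u' i)⁻¹ * δ (u' i)) : K) : ℝ⸨X⸩) =
        HahnSeries.C (e i) * ((u i)⁻¹ * (c * LaurentSeries.derivative ℝ (u i))) := fun i => by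
      rw [IntermediateField.coe_mul, IntermediateField.coe_mul, IntermediateField.coe_inv,
        hδ (u' i), IntermediateField.coe_mul, hDk, IntermediateField.coe_algebraMap_apply,
        rosenProp_algebraMap_real_apply, hu' i]
    have h4 : ((δ v' : K) : ℝ⸨X⸩) = c * LaurentSeries.derivative ℝ v := by
      rw [hδ v', IntermediateField.coe_mul, hDk, hv']
    apply Subtype.val_injective
    rw [IntermediateField.coe_add, IntermediateField.coe_sum, ZeroMemClass.coe_zero, h4]
    simp only [h3]
    have h2 : ∑ i, HahnSeries.C (e i) * ((u i)⁻¹ * (c * LaurentSeries.derivative ℝ (u i))) +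
        c * LaurentSeries.derivative ℝ v =
        c * ((∑ j, HahnSeries.C (e j) * ((u j)⁻¹ * LaurentSeries.derivative ℝ (u j))) +
          LaurentSeries.derivative ℝ v) := by
      rw [mul_add, Finset.mul_sum]
      congr 1
      refine Finset.sum_congr rfl fun i _ => ?_
      ring
    rw [h2, hrel, mul_zero]
  have halg : IsAlgebraic ℝ (u' j) :=
    Rosenlicht.isAlgebraic_of_forall_derivation e he u' hu'0 v' H j
  have h0 : Dk (u' j) = 0 := Rosenlicht.derivation_eq_zero_of_isAlgebraic Dk halg
  have h1 := hDk (u' j)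
  rw [h0, ZeroMemClass.coe_zero, hu' j] at h1
  exact h1.symm

end Summit.KontsevichZagierPeriods.LiouvilleUnfolding.LogPrimitiveNL.AxSchanuelGerms

end
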